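import Summits.QuantumFields.YangMills.Theorems.UnitScaleTiltProp7FlatCoercivity
import Summits.QuantumFields.YangMills.Theorems.UnitScaleTiltProp7PinnedHodgeSplit
import HarnessLib

/-!
# Route `UnitScaleTilt`, crux K1 «MinimiserStabilityRegPr» (stmt-QuantumFields-19200), line «route-R» (`Lines/birth_routeR.lean` v2 5b75208179c6919a),
# stub P `stub_relPoincareOpt` — linear flat core P-lin-flat, step N5 of ★p1 g11's plan (CARD-19200-V3-g11 §2): THE FACE FLUX OF A DIVERGENCE-FREE BOND
# FIELD THROUGH THE BLOCK FACES IS A CO-CLOSED COARSE 1-FORM, EXACTLY ORTHOGONAL TO EVERY COARSE GRADIENT (volume-free — no coarse Poincaré)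

Cell `ym3-torus`, width seat `ym-ust-20520-w2` (g2), OWNER RULING 2026-08-28 02:13:50Z «N5 (FACE FLUX) = ★w2-20520 g2».  THEOREMS ONLY (0 `def`, 0 `sorry`);
`--supports stmt-QuantumFields-19200`, count-neutral.  YM₃ on T³ is a ladder rung (R3), not the Clay problem; nothing here claims P, the stub, the crux or the gap.

SETTING (★p1's `Prop7FlatCoercivity` letters, d-generic).  A fine torus `T^{(i)} = Site P i` lying `e` block levels above a coarse torus `T^{(i′)} = Site P i'`
(`h : P.sitesPerDir i = P.L ^ e * P.sitesPerDir i'`), the block map `Site.proj i' e : Site P i → Site P i'` (`x ↦ ⌊x/L^e⌋`, `B1RG242Torus`), `ℓ = L^e`.  For a coarse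
bond `c = ⟨y, μ⟩` the FACE between the blocks `B^e(y)` and `B^e(y + e_μ)` is crossed by the fine bonds `⟨x, μ⟩` with `proj x = y` and `proj (x + e_μ) = y + e_μ`
(`ℓ^{d−1}` of them); the FACE SUM of a fine bond field `B` is written as the explicit term
`FS B c := ∑ x ∈ univ.filter (fun x : Site P i => Site.proj i' e x = c.src ∧ Site.proj i' e (x.shift c.dir) = c.tgt), B ⟨x, c.dir⟩`
in every statement (no definition; N7 scales by `ℓ^{−(d−1)}` to get the CARD's face flux `F_c`).

WHAT IS PROVED (ns `…Theorems.Prop7FaceFlux`).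
* §1 ★ `proj_shift_eq_or` — a unit step either stays in its block or enters the next block in its direction: `proj (x + e_μ) = proj x ∨ proj (x + e_μ) = proj x + e_μ`
  (wrap-around included); `proj_shift_of_ne` (the other coordinates' blocks do not move).
* §2 ★ `sum_mul_coarseGrad_proj_eq_zero` — for `∂^*B = 0` (`diverg c₀ B = 0`, `c₀ ≠ 0`) and every coarse `g`, `Σ_{fine b} B(b)·(g(proj b₊) − g(proj b₋)) = 0`:
  `LatticeFieldCalculus.sum_grad_mul` against the BLOCK-CONSTANT extension `g ∘ proj`, whose fine gradient lives on the faces only.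
* §3 ★ `sum_faceFlux_mul_coarseGrad_eq_zero` — `Σ_{coarse c} (g(c₊) − g(c₋))·FS B c = 0` for every coarse `g` (regrouping §2 by faces through §1): the face flux is EXACTLY
  orthogonal to every coarse gradient — the «coarse Hodge orthogonality» N7 consumes; no coarse Poincaré inequality, hence volume-free.
* §4 ★ `faceFlux_coclosed` — `∂^*(FS B) = 0` on the coarse torus (§3 at the indicator `g := δ_y`: the block divergence theorem «the 2d face fluxes of a block sum to
  `Σ_{x ∈ block} (∂^*B)(x) = 0`»).
HONEST SCOPE.  Linear, flat, abelian lattice calculus ([folklore]); the tent-mean comparison (iii) of the CARD (`|M_e B(c) − ℓ^{−(d−1)}FS B c|² ≤ …`) and the assembly N7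
are separate; nothing of Bałaban's analysis is asserted.

References: T. Bałaban, CMP 95 (1984) 17–40 [Balaban1984PropagatorsI] ((1.11)–(1.13) p.19, (1.21) p.21); CMP 89 (1983) 571–597 [Balaban1983RegularityDecay]
((2.27) p.580); CMP 102 (1985) 277–309 [Balaban1985Variational] (Prop. 7 p.299, (141)–(143)).
-/

noncomputable section

open scoped BigOperators

namespace Summit.QuantumFields.YangMills.Theorems.Prop7FaceFlux

open Literature.MathematicalPhysics.QuantumFieldTheory.Balaban1983to89
open Finset LatticeFieldCalculus
open B10StarCount (sum_pbond unshift_shift shift_unshift shift_apply_self shift_apply_ne)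

variable {P : Params} {i i' e : ℕ}

/-! ## §1 A unit step and the block map -/

/-- Off the direction of the step the block coordinates do not change: `(proj (x + e_μ)) ν = (proj x) ν` for `ν ≠ μ`. [folklore] -/
theorem proj_shift_of_ne (x : Site P i) {μ ν : Fin P.d} (hν : ν ≠ μ) :
    Site.proj i' e (x.shift μ) ν = Site.proj i' e x ν := by
  simp only [Site.proj, Site.shift, Function.update_of_ne hν]

/-- The `μ`-coordinate of `x + e_μ` as the cast of a natural label. [folklore] -/
theorem shift_apply_self_eq_natCast (x : Site P i) (μ : Fin P.d) :
    (x.shift μ) μ = (((x μ).val + 1 : ℕ) : ZMod (P.sitesPerDir i)) := by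
  simp only [Site.shift, Function.update_self, Nat.cast_add, Nat.cast_one, ZMod.natCast_val, ZMod.cast_id', id_eq]

/-- **LAST LAYER ⇒ NEXT BLOCK**: if `L^e ∣ x_μ + 1` (i.e. `x` lies on the last layer `x_μ ≡ L^e − 1 (mod L^e)` of its block in direction `μ`) then
`proj (x + e_μ) = (proj x) + e_μ` — the wrap-around `x_μ = N − 1 ↦ 0` of the fine torus lands in the block `(N′ − 1) + 1 = 0` of the coarse one
(`sitesPerDir i = L^e · sitesPerDir i'`).  The `e`-level analogue of `B10StarCount.blockOf_shift` (one level, `blockOf`). [folklore] -/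
theorem proj_shift_of_dvd (h : P.sitesPerDir i = P.L ^ e * P.sitesPerDir i') (x : Site P i) (μ : Fin P.d)
    (hdvd : P.L ^ e ∣ (x μ).val + 1) : Site.proj i' e (x.shift μ) = (Site.proj i' e x).shift μ := by
  classical
  have hℓpos : 0 < P.L ^ e := pow_pos P.L_pos e
  have hN'pos : 0 < P.sitesPerDir i' := Nat.pos_of_ne_zero (P.sitesPerDir_ne_zero i')
  have hvN : (x μ).val < P.sitesPerDir i := ZMod.val_lt (x μ)
  funext ν
  by_cases hν : ν = μ
  · subst hν
    rw [shift_apply_self]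
    show ((((x.shift ν) ν).val / P.L ^ e : ℕ) : ZMod (P.sitesPerDir i')) = ((((x ν).val / P.L ^ e : ℕ)) : ZMod (P.sitesPerDir i')) + 1
    rw [shift_apply_self_eq_natCast]
    obtain ⟨q, hq⟩ := hdvd
    have hq1 : 1 ≤ q := by
      rcases Nat.eq_zero_or_pos q with h0 | h0
      · rw [h0, mul_zero] at hq; omega
      · exact h0
    -- `v + 1 = ℓ q`, so `v / ℓ = q − 1`
    have hvq : (x ν).val / P.L ^ e = q - 1 := by
      have hv : (x ν).val = P.L ^ e * (q - 1) + (P.L ^ e - 1) := by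
        have h1 : P.L ^ e * q = P.L ^ e * (q - 1) + P.L ^ e := by
          rw [← Nat.mul_succ, Nat.succ_eq_add_one, Nat.sub_add_cancel hq1]
        omega
      rw [hv, Nat.mul_add_div hℓpos, Nat.div_eq_of_lt (Nat.sub_lt hℓpos one_pos), add_zero]
    rw [hvq]
    by_cases hwrap : (x ν).val + 1 < P.sitesPerDir i
    · -- no wrap-around on the fine torus
      rw [ZMod.val_natCast, Nat.mod_eq_of_lt hwrap, hq, Nat.mul_div_cancel_left q hℓpos]
      push_cast [Nat.cast_sub hq1]
      ring
    · -- wrap-around: `v + 1 = N = ℓ N′`; the fine coordinate becomes `0`, the coarse one `(N′ − 1) + 1 = 0`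
      have hvN1 : (x ν).val + 1 = P.sitesPerDir i := by omega
      have hval0 : ((((x ν).val + 1 : ℕ) : ZMod (P.sitesPerDir i))).val = 0 := by
        rw [hvN1, ZMod.natCast_self, ZMod.val_zero]
      rw [hval0, Nat.zero_div, Nat.cast_zero]
      have hqN : q = P.sitesPerDir i' := by
        have h2 : P.L ^ e * q = P.L ^ e * P.sitesPerDir i' := by rw [← hq, hvN1, h]
        exact Nat.eq_of_mul_eq_mul_left hℓpos h2
      rw [hqN]
      have h3 : (((P.sitesPerDir i' - 1 : ℕ)) : ZMod (P.sitesPerDir i')) + 1 = ((P.sitesPerDir i' - 1 + 1 : ℕ) : ZMod (P.sitesPerDir i')) := by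
        push_cast; ring
      rw [h3, Nat.sub_add_cancel hN'pos, ZMod.natCast_self]
  · rw [proj_shift_of_ne x hν, shift_apply_ne _ hν]

/-- **INTERIOR LAYER ⇒ SAME BLOCK**: if `L^e ∤ x_μ + 1` then `proj (x + e_μ) = proj x` (`sitesPerDir i = L^e · sitesPerDir i'`; no wrap-around can
occur since `L^e ∣ N`). [folklore] -/
theorem proj_shift_of_not_dvd (h : P.sitesPerDir i = P.L ^ e * P.sitesPerDir i') (x : Site P i) (μ : Fin P.d)
    (hdvd : ¬ P.L ^ e ∣ (x μ).val + 1) : Site.proj i' e (x.shift μ) = Site.proj i' e x := by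
  classical
  have hvN : (x μ).val < P.sitesPerDir i := ZMod.val_lt (x μ)
  funext ν
  by_cases hν : ν = μ
  · subst hν
    show ((((x.shift ν) ν).val / P.L ^ e : ℕ) : ZMod (P.sitesPerDir i')) = ((((x ν).val / P.L ^ e : ℕ)) : ZMod (P.sitesPerDir i'))
    rw [shift_apply_self_eq_natCast]
    have hwrap : (x ν).val + 1 < P.sitesPerDir i := by
      rcases Nat.lt_or_ge ((x ν).val + 1) (P.sitesPerDir i) with hlt | hge
      · exact hlt
      · exfalso
        have hvN1 : (x ν).val + 1 = P.sitesPerDir i := by omega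
        apply hdvd
        rw [hvN1, h]
        exact Dvd.intro _ rfl
    rw [ZMod.val_natCast, Nat.mod_eq_of_lt hwrap]
    congr 1
    -- `ℓ ∤ v + 1` ⇒ `(v + 1) / ℓ = v / ℓ`
    rw [Nat.succ_div, if_neg hdvd, add_zero]
  · exact proj_shift_of_ne x hν

/-- ★ **A UNIT STEP STAYS IN ITS BLOCK OR ENTERS THE NEXT ONE**: for `sitesPerDir i = L^e · sitesPerDir i'`, every fine site `x` and direction `μ`,
`proj (x + e_μ) = proj x` or `proj (x + e_μ) = (proj x) + e_μ` (wrap-around included). [folklore] -/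
theorem proj_shift_eq_or (h : P.sitesPerDir i = P.L ^ e * P.sitesPerDir i') (x : Site P i) (μ : Fin P.d) :
    Site.proj i' e (x.shift μ) = Site.proj i' e x ∨ Site.proj i' e (x.shift μ) = (Site.proj i' e x).shift μ := by
  by_cases hdvd : P.L ^ e ∣ (x μ).val + 1
  · exact Or.inr (proj_shift_of_dvd h x μ hdvd)
  · exact Or.inl (proj_shift_of_not_dvd h x μ hdvd)

/-- The last-layer test in residue form: `ℓ ∣ v + 1 ↔ v % ℓ + 1 = ℓ` (`ℓ > 0`; the form used by `B10StarCount.blockOf_shift`). [folklore] -/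
theorem dvd_succ_iff_mod_succ_eq {ℓ : ℕ} (hℓ : 0 < ℓ) (v : ℕ) : ℓ ∣ v + 1 ↔ v % ℓ + 1 = ℓ := by
  obtain ⟨k, rfl⟩ : ∃ k, ℓ = k + 1 := ⟨ℓ - 1, by omega⟩
  rw [Nat.dvd_iff_mod_eq_zero, Nat.succ_mod_succ_eq_zero_iff]
  omega

/-! ## §2 The fine-level identity: a divergence-free field is orthogonal to the gradient of every block-constant function -/

/-- ★ **`Σ_b B(b)·(g(proj b₊) − g(proj b₋)) = 0`** for `∂^*B = 0` (`diverg c₀ B = 0`, `c₀ ≠ 0`) and every coarse function `g` — summation by parts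
(`LatticeFieldCalculus.sum_grad_mul`) against the block-constant extension `g ∘ proj`. [cite: Balaban1984PropagatorsI, (1.21) p.21] -/
theorem sum_mul_coarseGrad_proj_eq_zero {c₀ : ℝ} (hc₀ : c₀ ≠ 0) {B : PBond P i → ℝ} (hB : diverg c₀ B = 0) (g : Site P i' → ℝ) :
    ∑ b : PBond P i, B b * (g (Site.proj i' e b.tgt) - g (Site.proj i' e b.src)) = 0 := by
  have hparts := sum_grad_mul c₀ (fun x : Site P i => g (Site.proj i' e x)) B
  simp only [hB, Pi.zero_apply, mul_zero, Finset.sum_const_zero] at hparts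
  -- `c₀ · Σ_b B b (g(proj b₊) − g(proj b₋)) = Σ_b (∂(g∘proj))(b) · B b = 0`
  have h2 : c₀ * ∑ b : PBond P i, B b * (g (Site.proj i' e b.tgt) - g (Site.proj i' e b.src))
      = ∑ b : PBond P i, grad c₀ (fun x : Site P i => g (Site.proj i' e x)) b * B b := by
    rw [Finset.mul_sum]
    refine Finset.sum_congr rfl fun b _ => ?_
    simp only [grad, smul_eq_mul]
    ring
  rw [hparts] at h2
  exact (mul_eq_zero.1 h2).resolve_left hc₀

/-! ## §3 ★ Exact orthogonality of the face flux to the coarse gradients -/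

/-- Regrouping a fine-bond sum by direction and by the block of the source site. [folklore] -/
theorem sum_pbond_fiberwise {M : Type*} [AddCommMonoid M] (F : PBond P i → M) :
    ∑ b : PBond P i, F b = ∑ μ : Fin P.d, ∑ y : Site P i', ∑ x ∈ univ.filter (fun x : Site P i => Site.proj i' e x = y), F ⟨x, μ⟩ := by
  classical
  rw [sum_pbond, Finset.sum_comm]
  refine Finset.sum_congr rfl fun μ _ => ?_
  rw [← Finset.sum_fiberwise (s := (univ : Finset (Site P i))) (g := Site.proj i' e) (f := fun x => F ⟨x, μ⟩)]

/-- On one block and one direction: the terms `B⟨x,μ⟩·(g(proj(x+e_μ)) − g(proj x))` over `x ∈ B^e(y)` add up to `(g(y+e_μ) − g(y))·FS B ⟨y,μ⟩` — the bonds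
staying inside the block contribute nothing (§1). [folklore] -/
theorem blockSum_mul_coarseGrad_eq (h : P.sitesPerDir i = P.L ^ e * P.sitesPerDir i') (B : PBond P i → ℝ) (g : Site P i' → ℝ)
    (μ : Fin P.d) (y : Site P i') :
    ∑ x ∈ univ.filter (fun x : Site P i => Site.proj i' e x = y), B ⟨x, μ⟩ * (g (Site.proj i' e (x.shift μ)) - g (Site.proj i' e x))
      = (g (y.shift μ) - g y) *
          ∑ x ∈ univ.filter (fun x : Site P i => Site.proj i' e x = y ∧ Site.proj i' e (x.shift μ) = y.shift μ), B ⟨x, μ⟩ := by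
  classical
  -- split the block into the face layer and the rest
  rw [Finset.mul_sum]
  have hsplit := (Finset.sum_filter_add_sum_filter_not (univ.filter (fun x : Site P i => Site.proj i' e x = y))
    (fun x : Site P i => Site.proj i' e (x.shift μ) = y.shift μ)
    (fun x => B ⟨x, μ⟩ * (g (Site.proj i' e (x.shift μ)) - g (Site.proj i' e x)))).symm
  rw [hsplit]
  have hface : ∑ x ∈ (univ.filter (fun x : Site P i => Site.proj i' e x = y)).filter (fun x : Site P i => Site.proj i' e (x.shift μ) = y.shift μ),
      B ⟨x, μ⟩ * (g (Site.proj i' e (x.shift μ)) - g (Site.proj i' e x))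
      = ∑ x ∈ univ.filter (fun x : Site P i => Site.proj i' e x = y ∧ Site.proj i' e (x.shift μ) = y.shift μ), (g (y.shift μ) - g y) * B ⟨x, μ⟩ := by
    rw [Finset.filter_filter]
    refine Finset.sum_congr rfl fun x hx => ?_
    obtain ⟨hx1, hx2⟩ := (Finset.mem_filter.1 hx).2
    rw [hx1, hx2]; ring
  have hrest : ∑ x ∈ (univ.filter (fun x : Site P i => Site.proj i' e x = y)).filter (fun x : Site P i => ¬ Site.proj i' e (x.shift μ) = y.shift μ),
      B ⟨x, μ⟩ * (g (Site.proj i' e (x.shift μ)) - g (Site.proj i' e x)) = 0 := by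
    refine Finset.sum_eq_zero fun x hx => ?_
    obtain ⟨hx1, hx2⟩ := Finset.mem_filter.1 hx
    have hx1' : Site.proj i' e x = y := (Finset.mem_filter.1 hx1).2
    rcases proj_shift_eq_or h x μ with hin | hout
    · rw [hin, hx1', sub_self, mul_zero]
    · exact absurd (by rw [hout, hx1']) hx2
  rw [hface, hrest, add_zero]

/-- ★ **THE FACE FLUX IS EXACTLY ORTHOGONAL TO EVERY COARSE GRADIENT**: for a divergence-free fine bond field `B` (`diverg c₀ B = 0`, `c₀ ≠ 0`) and every coarse
function `g`, `Σ_{coarse bonds c} (g(c₊) − g(c₋)) · FS B c = 0`, `FS B c` the face sum of `B` through the face of `c` — no coarse Poincaré inequality, hence uniform in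
the volume. [cite: Balaban1984PropagatorsI, (1.11)–(1.13) p.19, (1.21) p.21] -/
theorem sum_faceFlux_mul_coarseGrad_eq_zero (h : P.sitesPerDir i = P.L ^ e * P.sitesPerDir i') {c₀ : ℝ} (hc₀ : c₀ ≠ 0)
    {B : PBond P i → ℝ} (hB : diverg c₀ B = 0) (g : Site P i' → ℝ) :
    ∑ c : PBond P i', (g c.tgt - g c.src) *
        ∑ x ∈ univ.filter (fun x : Site P i => Site.proj i' e x = c.src ∧ Site.proj i' e (x.shift c.dir) = c.tgt), B ⟨x, c.dir⟩ = 0 := by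
  classical
  have hfine := sum_mul_coarseGrad_proj_eq_zero (i' := i') (e := e) hc₀ hB g
  rw [sum_pbond_fiberwise (i' := i') (e := e)] at hfine
  rw [sum_pbond, Finset.sum_comm]
  rw [← hfine]
  refine Finset.sum_congr rfl fun μ _ => Finset.sum_congr rfl fun y _ => ?_
  simp only [PBond.tgt]
  exact (blockSum_mul_coarseGrad_eq h B g μ y).symm

/-! ## §4 ★ The face flux is co-closed on the coarse torus (block divergence theorem) -/

/-- ★ **`∂^*(FS B) = 0` ON THE COARSE TORUS** for a divergence-free fine field `B`: the coarse divergence of the face sums at a coarse site `y` is the net flux out of the block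
`B^e(y)` through its `2d` faces, i.e. `Σ_{x ∈ B^e(y)} (∂^*B)(x) = 0` (§3 at the indicator function of `y`). [cite: Balaban1984PropagatorsI, (1.21) p.21] -/
theorem faceFlux_coclosed (h : P.sitesPerDir i = P.L ^ e * P.sitesPerDir i') {c₀ : ℝ} (hc₀ : c₀ ≠ 0)
    {B : PBond P i → ℝ} (hB : diverg c₀ B = 0) (c' : ℝ) (y : Site P i') :
    diverg c' (fun c : PBond P i' =>
      ∑ x ∈ univ.filter (fun x : Site P i => Site.proj i' e x = c.src ∧ Site.proj i' e (x.shift c.dir) = c.tgt), B ⟨x, c.dir⟩) y = 0 := by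
  classical
  -- §3 at the indicator of `y`
  have key := sum_faceFlux_mul_coarseGrad_eq_zero h hc₀ hB (fun z : Site P i' => if z = y then (1 : ℝ) else 0)
  -- evaluate the coarse-bond sum: only the bonds ending at `y` (weight +1) and starting at `y` (weight −1) survive
  rw [sum_pbond] at key
  simp only [diverg, smul_eq_mul]
  have hreidx : ∀ μ : Fin P.d, ∑ z : Site P i', ((if (PBond.tgt ⟨z, μ⟩) = y then (1 : ℝ) else 0) - (if z = y then 1 else 0)) *
        ∑ x ∈ univ.filter (fun x : Site P i => Site.proj i' e x = z ∧ Site.proj i' e (x.shift μ) = PBond.tgt ⟨z, μ⟩), B ⟨x, μ⟩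
      = (∑ x ∈ univ.filter (fun x : Site P i => Site.proj i' e x = y.unshift μ ∧ Site.proj i' e (x.shift μ) = PBond.tgt ⟨y.unshift μ, μ⟩), B ⟨x, μ⟩)
        - ∑ x ∈ univ.filter (fun x : Site P i => Site.proj i' e x = y ∧ Site.proj i' e (x.shift μ) = PBond.tgt ⟨y, μ⟩), B ⟨x, μ⟩ := by
    intro μ
    simp only [sub_mul, Finset.sum_sub_distrib, ite_mul, one_mul, zero_mul]
    congr 1
    · -- the bond ending at `y` starts at `y − e_μ`
      rw [Finset.sum_ite, Finset.sum_const_zero, add_zero]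
      have hfilt : univ.filter (fun z : Site P i' => PBond.tgt ⟨z, μ⟩ = y) = {y.unshift μ} := by
        ext z
        simp only [Finset.mem_filter, Finset.mem_univ, true_and, Finset.mem_singleton, PBond.tgt]
        constructor
        · intro hz; rw [← hz, unshift_shift]
        · intro hz; rw [hz, shift_unshift]
      rw [hfilt, Finset.sum_singleton]
    · rw [Finset.sum_ite_eq' univ y, if_pos (Finset.mem_univ y)]
  have key' : ∑ μ : Fin P.d, ((∑ x ∈ univ.filter (fun x : Site P i => Site.proj i' e x = y.unshift μ ∧ Site.proj i' e (x.shift μ) = PBond.tgt ⟨y.unshift μ, μ⟩), B ⟨x, μ⟩)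
        - ∑ x ∈ univ.filter (fun x : Site P i => Site.proj i' e x = y ∧ Site.proj i' e (x.shift μ) = PBond.tgt ⟨y, μ⟩), B ⟨x, μ⟩) = 0 := by
    rw [Finset.sum_comm] at key
    rw [← key]
    refine Finset.sum_congr rfl fun μ _ => ?_
    rw [← hreidx μ]
  rw [← Finset.mul_sum, key', mul_zero]

end Summit.QuantumFields.YangMills.Theorems.Prop7FaceFlux

end
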